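import Summits.HodgeConjecture.HodgeConjecture.Theorems.Ring2HypothesesWeilComponentsSplit
import Summits.HodgeConjecture.HodgeConjecture.Theorems.Ring2AbelianAllWeilSignature
import Summits.HodgeConjecture.HodgeConjecture.Theorems.Ring2AbelianAllWeilDiscriminantDescent
import Literature.AlgebraicGeometry.VanGeemen1994.HyperbolicOfSplitDiscriminant
import Literature.AlgebraicGeometry.VanGeemen1994.WeilDiscriminantOfProductTop
import Literature.AlgebraicGeometry.VanGeemen1994.WeilKFrame
import Literature.AlgebraicGeometry.Motives.SegreHyperplaneClassProdCurve
import Literature.AlgebraicGeometry.Motives.AimedSplitProductDischarge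
import Literature.AlgebraicGeometry.HodgeTheory.WeilSurfaceCMSquareModel
import HarnessLib

/-!
# Ring 2 · AbelianAll (seat `ab-weil-2`, gen 3) — `A × E_k` with `dim A` ODD: the weighted product polarization makes
  EVERY such Weil-type pair SPLIT (hyperbolic); the `E_k × Y₅` sixfold rows from the refereed sixfold facts

HONEST FRAMING (sub-cell `pub-hodge-ring2-ab-*`, verbatim): research route, not a corollary; conditional on HC_CM plus
one named minimal statement. (Cell `pub-hodge-ring2`, verbatim: research route conditional on HC_CM; not a corollary;
Q11.4-sentence-2 already refuted in dim ≥ 3.) `HC_CM` does not occur here. No definition, no named fact, no `sorry`; §2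
takes the refereed sixfold facts (Koike 2004, Schoen 1998) / the unrefereed F2 (Markman 2025) as BINDERS.

WHAT IS PROVED. §1 `isSplitWeilType_odd_prod_curve` — the general form of `hasDiscOneWeilStructure_threefold_prod_curve`
(file `Ring2AbelianAllCurveTimesThreefold`): for `A` of ODD dimension `m + 1 = 2N - 1 ≥ 3` and an elliptic curve `E`, with
`φ ≫ φ = -d` on `A`, `ψ ≫ ψ = -d` on `E`, and `(A × E, φ × ψ)` of Weil type `(N, N)`, the pair is of SPLIT Weil type: the
weighted Segre polarization `L_A ⊠ L_E^{⊗M}` has discriminant class `[M^{2N-1} · C] = [M · C]` (ODD `K`-rank `2N - 1` of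
the factor `A`: "factorwise rescaling", WEIL-CELLS §C / atlas-2 §16, DERIVED there — now a theorem), `sign C = (-1)ᴺ`
(van Geemen 5.2 (4), ab-weil-1), so `M = |num C|·den C` gives `[(-1)ᴺ]`, and Landherr's converse (this seat, gen 3) gives
a hyperbolic frame. §2: for `N = 3` (`A = Y₅` a fivefold, atlas rows `E_k × Y₅(3,2)`) the Weil classes of `Y₅ × E_k` are
ALGEBRAIC granted ONE sixfold fact by name — Koike 2004 (`k = ℚ(i)`), Schoen 1998 (`k = ℚ(√-3)`), or F2 (any `k`,
unrefereed) — the hyperbolic-sixfold facts applied DIRECTLY to the split pair (no Landherr, no component binder); and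
for every `N` granted the split cell `(N, d, [(-1)ᴺ])` alone (`WeilClassesComponent`, binder).

## References

* [MoonenZarhin1999LowDim] B. Moonen, Yu. Zarhin, Math. Ann. 315 (1999), Thm. 0.1 (a), §5.
* [vanGeemen1994HodgeAV] B. van Geemen, LNM 1594 (1994), Lemma 5.2 (2)–(4), 5.4 and (5.4.1).
* [Landherr1936HermitianForms] W. Landherr, Abh. Math. Sem. Hamburg 11 (1936) 245–248.
* [Koike2004WeilHodge] K. Koike (2004), Thm. 2.1, Cor. 2.1. [Schoen1998HodgeWeilAddendum] C. Schoen, Compositio 114 (1998).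
  [Markman2025SecantWeil] E. Markman, arXiv:2502.03415 (unrefereed), Thm. 1.5.1. [Abdulali2016TateTwists] App. A 4.
-/

set_option linter.dupNamespace false

noncomputable section

open CategoryTheory

namespace Summit.HodgeConjecture.HodgeConjecture.Ring2.AbelianAll

open Literature.AlgebraicGeometry Literature.AlgebraicGeometry.Motives
open Literature.AlgebraicGeometry.HodgeTheory Literature.AlgebraicGeometry.VanGeemen1994
open Literature.AlgebraicTopology.SingularHomology
open Literature.Geometry.Kaehler
open Summit.HodgeConjecture.HodgeConjecture.WeilTypeLadder
open Summit.HodgeConjecture.HodgeConjecture.Theses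
open Summit.HodgeConjecture.HodgeConjecture.Ring2.Hypotheses

/-! ## §1 Odd-dimensional factor times a curve: always split -/

/-- **`A × E` with `dim A = 2N - 1` ODD is of SPLIT Weil type whenever it is of Weil type `(N, N)`** (the "factorwise
rescaling" of WEIL-CELLS §C / atlas-2 §16, now a theorem; MZ99 Thm. 0.1 (a) is `N = 2`). Data: `A` of dimension `m + 1`,
`m + 2 = 2N`, `N ≥ 2`; `E` an elliptic curve; `φ ≫ φ = -(d • 𝟙 A)`, `ψ ≫ ψ = -(d • 𝟙 E)` (`d ≥ 1`);
`(A × E, φ × ψ)` of Weil type `(N, N)`. Conclusion: `IsSplitWeilType (A × E) (φ × ψ) N d` — some `K`-symmetrised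
hyperplane class (the weighted Segre class `L_A ⊠ L_E^{⊗M}`, `M = |num C|·den C`) is HYPERBOLIC. Proof: product
discriminant `[((m+1)·2dsM)^{m+1} · t_A · q_A] = [M·C]` (`m + 1` odd), `sign C = (-1)ᴺ` (ab-weil-1's
`weilSign_eq_of_hasWeilDiscriminantNondeg`), Landherr's converse (`VanGeemen1994.isHyperbolicWeilType_of_hasWeilDiscriminantNondeg_split`).
No named fact. [cite: MoonenZarhin1999LowDim, Thm. 0.1 (a)] [cite: vanGeemen1994HodgeAV, Lemma 5.2 (2)–(4), 5.4 and (5.4.1)]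
[cite: Landherr1936HermitianForms] -/
theorem isSplitWeilType_odd_prod_curve {A E : AbelianVariety ℂ} {m N : ℕ} (hA : A.dim = m + 1) (hmN : m + 2 = 2 * N)
    (hN : 2 ≤ N) (hE : E.dim = 1) {d : ℕ} (hd : 0 < d) {φ : A ⟶ A} {ψ : E ⟶ E} (hφ : φ ≫ φ = -(d • 𝟙 A))
    (hψ : ψ ≫ ψ = -(d • 𝟙 E))
    (hW : IsWeilType (A.prod E)
      (AbelianVariety.prodLift (AbelianVariety.fst A E ≫ φ) (AbelianVariety.snd A E ≫ ψ)) N d) :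
    IsSplitWeilType (A.prod E)
      (AbelianVariety.prodLift (AbelianVariety.fst A E ≫ φ) (AbelianVariety.snd A E ≫ ψ)) N d := by
  classical
  set Φ := AbelianVariety.prodLift (AbelianVariety.fst A E ≫ φ) (AbelianVariety.snd A E ≫ ψ) with hΦ
  have hΦ2 : Φ ≫ Φ = -(d • 𝟙 (A.prod E)) := prodLift_comp_self_eq_neg_nsmul hφ hψ
  have hm : 1 ≤ m := by omega
  have hE' : E.dim = 0 + 1 := by rw [hE]
  -- (1) the curve: frame `(v, ψ^* v)`, reference class `η₀ = v ∪ ψ^*v`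
  obtain ⟨u, η₀, hur, hui, -, hMu, -, hη₀r, hη₀0, hgram, -, hψ2, -⟩ := cmCurve_rationalModel hE hd hψ
  change complexBetti E.X 2 at η₀
  have hψη : complexBetti.map ψ.hom.hom.hom 2 η₀ = (d : ℂ) • η₀ := hψ2 η₀
  have hu1 : complexBetti.map ψ.hom.hom.hom 1 (u 0) = u 1 := by
    rw [hMu 0, Fin.sum_univ_two]
    simp
  set xB : Fin 1 → complexBetti E.X 1 := fun _ => u 0 with hxB
  have hxBr : ∀ i, IsRationalClass (xB i) := fun _ => hur 0
  have hiB : LinearIndependent ℂ (Sum.elim xB (fun i => complexBetti.map ψ.hom.hom.hom 1 (xB i))) := by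
    let ι₂ : Fin 1 ⊕ Fin 1 → Fin 2 := Sum.elim (fun _ => 0) (fun _ => 1)
    have hι₂ : Function.Injective ι₂ := by
      rintro (i | i) (j | j) h
      · rw [Subsingleton.elim i j]
      · exact absurd h (by simp [ι₂])
      · exact absurd h (by simp [ι₂])
      · rw [Subsingleton.elim i j]
    have heq : Sum.elim xB (fun i => complexBetti.map ψ.hom.hom.hom 1 (xB i)) = u ∘ ι₂ := by
      funext s
      rcases s with i | i
      · rfl
      · simp only [Sum.elim_inr, Function.comp_apply, ι₂, hxB, hu1]
    rw [heq]
    exact hui.comp ι₂ hι₂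
  set aB : Matrix (Fin 1) (Fin 1) ℚ := fun _ _ => 1 with haB
  set bB : Matrix (Fin 1) (Fin 1) ℚ := fun _ _ => 0 with hbB
  have hpB : ∀ (c : ℚ) (i j : Fin 1),
      polarizationPairingOne E.X (((c : ℚ) : ℂ) • η₀) 0 (xB i) (complexBetti.map ψ.hom.hom.hom 1 (xB j)) =
          ((aB i j : ℚ) : ℂ) • η₀ ∧
        polarizationPairingOne E.X (((c : ℚ) : ℂ) • η₀) 0 (xB i) (xB j) = ((bB i j : ℚ) : ℂ) • η₀ := by
    intro c i j
    refine ⟨?_, ?_⟩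
    · simp only [hxB, haB, hu1]
      rw [hgram]
      simp
    · simp only [hxB, hbB]
      rw [hgram]
      simp
  have hqB : (weilGramMatrix d aB bB).det = algebraMap ℚ (weilField d) ((1 : ℚˣ) : ℚ) := by
    rw [Matrix.det_unique, weilGramMatrix_apply]
    simp [haB, hbB]
  -- (2) the symmetric Segre data of `A` and the `K`-frame of `(A, φ, h_K^A)`
  obtain ⟨eY, aY, s, haY, haY0, hsym, hemb⟩ := exists_symmetricSegreEmbedding_prodCurve hd hφ E hE η₀ hη₀r hη₀0
  obtain ⟨xA, ωA, aA, bA, qA, tA, hxA, hiA, hωA, hωA0, hpA, hqA, htA⟩ :=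
    exists_kFrame_ksymm hm hA hd hφ eY haY haY0
  set hKY := (d : ℂ) • complexBetti.map eY.ι 2 aY + complexBetti.map φ.hom.hom.hom 2 (complexBetti.map eY.ι 2 aY)
    with hKYdef
  -- the `K`-symmetrised class of the weighted Segre embedding is the product class
  have hKP : ∀ (M : ℕ) (e : ProjectiveEmbedding (A.prod E).X) (a : complexBetti (projectiveSpace e.n ℂ) 2),
      complexBetti.map e.ι 2 a =
        complexBetti.map (AbelianVariety.fst A E).hom.hom.hom 2 (complexBetti.map eY.ι 2 aY) +
          ((s * M : ℚ) : ℂ) • complexBetti.map (AbelianVariety.snd A E).hom.hom.hom 2 η₀ →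
      (d : ℂ) • complexBetti.map e.ι 2 a + complexBetti.map Φ.hom.hom.hom 2 (complexBetti.map e.ι 2 a) =
        complexBetti.map (AbelianVariety.fst A E).hom.hom.hom 2 hKY +
          complexBetti.map (AbelianVariety.snd A E).hom.hom.hom 2 ((((2 * d * s * M : ℚ)) : ℂ) • η₀) := by
    intro M e a he
    rw [he, map_add, map_smul, map_prodLift_map_fst φ ψ 2, map_prodLift_map_snd φ ψ 2, hψη, hKYdef, map_add,
      map_smul, map_smul, map_smul]
    simp only [smul_add, smul_smul]
    push_cast
    module
  -- (3) the product witness of weight `M`, with its non-vanishing weights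
  have hN2 : 2 * N = m + 0 + 2 := by omega
  let ε : Fin (m + 1) ⊕ Fin 1 ≃ Fin (2 * N) := finSumFinEquiv.trans (finCongr (by omega))
  have witness : ∀ M : ℕ, 0 < M → ∃ (e : ProjectiveEmbedding (A.prod E).X) (a : complexBetti (projectiveSpace e.n ℂ) 2)
      (w : ℚˣ), IsRationalClass a ∧ a ≠ 0 ∧
        (w : ℚ) = (((2 * N - 1).choose m : ℚ) * (2 * d * s * M)) ^ (m + 1) *
          ((((2 * N - 1).choose (m + 1) : ℚ)) * tA) ^ 1 * qA ∧
        HasWeilDiscriminantNondeg (A.prod E) Φ N d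
          ((d : ℂ) • complexBetti.map e.ι 2 a + complexBetti.map Φ.hom.hom.hom 2 (complexBetti.map e.ι 2 a))
          (QuotientGroup.mk w) := by
    intro M hM
    obtain ⟨e, a, ha, ha0, he⟩ := hemb M hM
    have hh := hKP M e a he
    obtain ⟨htA0, hc0⟩ := prod_kFrames_top_ne_zero hA hE' hN2 (kA := m + 1) (kB := 1) (by omega) (by omega)
      (by norm_num) hd hφ hψ xA hxA hiA hKY ωA aA bA hpA tA htA xB hxBr hiB ((((2 * d * s * M : ℚ)) : ℂ) • η₀) η₀
      aB bB (hpB _) (2 * d * s * M) (af_top_curve η₀ _) e ha ha0 hh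
    have hδ := hasWeilDiscriminantNondeg_prod_of_kFrames hA hE' hN2 ε xA hxA hiA hKY ωA hωA hωA0 aA bA hpA tA htA
      htA0 qA hqA xB hxBr hiB ((((2 * d * s * M : ℚ)) : ℂ) • η₀) η₀ hη₀r hη₀0 aB bB (hpB _) (2 * d * s * M)
      (af_top_curve η₀ _) hc0 1 hqB
    rw [← hh] at hδ
    refine ⟨e, a, _, ha, ha0, ?_, hδ⟩
    rw [Units.val_mul, Units.val_mul, Units.val_mk0, Units.val_one, mul_one]
  -- numerics of the binomial weights: `C(m+1, m) = m + 1`, `C(m+1, m+1) = 1`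
  have hc1 : ((2 * N - 1).choose m : ℚ) = (m + 1 : ℚ) := by
    rw [show 2 * N - 1 = m + 1 by omega, Nat.choose_succ_self_right, Nat.cast_succ]
  have hc2 : ((2 * N - 1).choose (m + 1) : ℚ) = 1 := by
    rw [show 2 * N - 1 = m + 1 by omega, Nat.choose_self, Nat.cast_one]
  -- (4) the sign at weight 1: `sign C = (-1)ᴺ` (van Geemen 5.2 (4) on the carriers)
  obtain ⟨e₁, a₁, w₁, ha₁, ha₁0, hw₁, hδ₁⟩ := witness 1 one_pos
  have hsign := weilSign_eq_of_hasWeilDiscriminantNondeg hW e₁ ha₁ ha₁0 hδ₁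
  rw [weilSign_mk_eq_neg_one_pow_iff] at hsign
  set C : ℚ := ((m + 1 : ℚ) * (2 * d * s)) ^ (m + 1) * tA * qA with hC
  have hw₁C : (w₁ : ℚ) = C := by
    rw [hw₁, hc1, hc2, hC]
    push_cast
    ring
  rw [hw₁C] at hsign
  have hC0 : C ≠ 0 := by
    intro h0
    rw [h0, mul_zero] at hsign
    exact lt_irrefl _ hsign
  -- (5) the weight `M = |num C| · den C`: `M · C = |num C| · num C`, and `m + 1 = 2(N-1) + 1` is odd
  set M : ℕ := C.num.natAbs * C.den with hMdef
  have hnum0 : C.num ≠ 0 := Rat.num_ne_zero.2 hC0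
  have hMpos : 0 < M := Nat.mul_pos (Int.natAbs_pos.2 hnum0) C.den_pos
  have hMC : (M : ℚ) * C = (C.num.natAbs : ℚ) * C.num := by
    rw [hMdef, Nat.cast_mul, mul_assoc, Rat.den_mul_eq_num]
  obtain ⟨e, a, w, ha, ha0, hw, hδ⟩ := witness M hMpos
  have hwval : (w : ℚ) = ((M : ℚ) ^ (N - 1)) ^ 2 * ((C.num.natAbs : ℚ) * C.num) := by
    have h3 : ((m + 1 : ℚ) * (2 * d * s * M)) ^ (m + 1) = (M : ℚ) ^ (m + 1) * ((m + 1 : ℚ) * (2 * d * s)) ^ (m + 1) := by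
      rw [← mul_pow]
      congr 1
      ring
    have h2 : (w : ℚ) = (M : ℚ) ^ (m + 1) * C := by
      rw [hw, hc1, hc2, hC, h3]
      ring
    rw [h2, show m + 1 = 2 * (N - 1) + 1 by omega, pow_succ, pow_mul', mul_assoc, hMC]
  have hMnz : (M : ℚ) ^ (N - 1) ≠ 0 := pow_ne_zero _ (by exact_mod_cast hMpos.ne')
  have hnzQ : (C.num : ℚ) ≠ 0 := by exact_mod_cast hnum0
  have hv0 : (M : ℚ) ^ (N - 1) * C.num ≠ 0 := mul_ne_zero hMnz hnzQ
  have hsq : Units.mk0 ((M : ℚ) ^ (N - 1) * C.num) hv0 ^ 2 ∈ normUnitsSubgroup ℚ (weilField d) := by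
    have h := pow_finrank_mem_normUnitsSubgroup (F := ℚ) (K := weilField d) (Units.mk0 ((M : ℚ) ^ (N - 1) * C.num) hv0)
    rwa [finrank_weilField] at h
  have hclass : (QuotientGroup.mk w : weilNormResidueGroup d) = QuotientGroup.mk ((-1 : ℚˣ) ^ N) := by
    rcases neg_one_pow_eq_or ℚ N with hpos | hneg
    · -- `(-1)ᴺ = 1`: `C > 0`, `|num C| · num C = (num C)²`, `w` is a square
      rw [hpos, one_mul] at hsign
      have hn : 0 < C.num := Rat.num_pos.2 hsign
      have habs : ((C.num.natAbs : ℕ) : ℚ) = (C.num : ℚ) := by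
        rw [← Int.cast_natCast, Int.natAbs_of_nonneg hn.le]
      have hwsq : w = Units.mk0 ((M : ℚ) ^ (N - 1) * C.num) hv0 ^ 2 :=
        Units.ext (by rw [hwval, habs, Units.val_pow_eq_pow_val, Units.val_mk0]; ring)
      have hunit : ((-1 : ℚˣ) ^ N) = 1 :=
        Units.ext (by rw [Units.val_pow_eq_pow_val, Units.val_neg, Units.val_one, hpos])
      rw [hunit, QuotientGroup.mk_one, hwsq]
      exact (QuotientGroup.eq_one_iff _).2 hsq
    · -- `(-1)ᴺ = -1`: `C < 0`, `|num C| · num C = -(num C)²`, `w = (-1)ᴺ · square`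
      rw [hneg, neg_one_mul, neg_pos] at hsign
      have hn : C.num < 0 := Rat.num_neg.2 hsign
      have habs : ((C.num.natAbs : ℕ) : ℚ) = -(C.num : ℚ) := by
        rw [← Int.cast_natCast, Int.ofNat_natAbs_of_nonpos hn.le, Int.cast_neg]
      have hwsq : w = (-1 : ℚˣ) ^ N * Units.mk0 ((M : ℚ) ^ (N - 1) * C.num) hv0 ^ 2 :=
        Units.ext (by
          rw [hwval, habs, Units.val_mul, Units.val_pow_eq_pow_val, Units.val_pow_eq_pow_val, Units.val_neg,
            Units.val_one, hneg, Units.val_mk0]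
          ring)
      rw [hwsq, QuotientGroup.mk_mul, (QuotientGroup.eq_one_iff _).2 hsq, mul_one]
  rw [hclass] at hδ
  -- (6) Landherr's converse on the carriers
  exact VanGeemen1994.IsWeilType.isSplitWeilType_of_hasWeilDiscriminantNondeg_split hW e ha ha0 hδ

/-! ## §2 Consequences: the Weil classes of `A × E_k` from ONE split-cell statement; `Y₅ × E_k` from ONE sixfold fact -/

/-- **The Weil classes of `A × E_k` (`dim A = 2N - 1`) are algebraic granted the split cell `(N, d, [(-1)ᴺ])` ALONE**
(binder `h : WeilClassesComponent N d (splitDiscriminantClass N d)`; no Landherr binder, no rescaling residue): §1 +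
`Ring2.Hypotheses.weilClasses_algebraic_of_isSplitWeilType_of_split_component`.
[cite: vanGeemen1994HodgeAV, Lemma 5.2 and (5.4.1)] [cite: MoonenZarhin1999LowDim, Thm. 0.1 (a)] -/
theorem weilClasses_algebraic_odd_prod_curve_of_split_component {A E : AbelianVariety ℂ} {m N : ℕ}
    (hA : A.dim = m + 1) (hmN : m + 2 = 2 * N) (hN : 2 ≤ N) (hE : E.dim = 1) {d : ℕ} (hd : 0 < d)
    (h : WeilClassesComponent N d (splitDiscriminantClass N d)) {φ : A ⟶ A} {ψ : E ⟶ E}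
    (hφ : φ ≫ φ = -(d • 𝟙 A)) (hψ : ψ ≫ ψ = -(d • 𝟙 E))
    (hW : IsWeilType (A.prod E)
      (AbelianVariety.prodLift (AbelianVariety.fst A E ≫ φ) (AbelianVariety.snd A E ≫ ψ)) N d)
    {c : complexBetti (A.prod E).X (2 * N)} (hcQ : IsRationalClass c)
    (hcH : IsOfHodgeType (2 * N) (A.prod E).X (2 * N) N N c)
    (hw : c ∈ weilClassesOf (A.prod E)
      (AbelianVariety.prodLift (AbelianVariety.fst A E ≫ φ) (AbelianVariety.snd A E ≫ ψ)) N d) :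
    c ∈ algebraicClasses (A.prod E).X N :=
  weilClasses_algebraic_of_isSplitWeilType_of_split_component h
    (isSplitWeilType_odd_prod_curve hA hmN hN hE hd hφ hψ hW) hcQ hcH hw

/-- **The Weil classes of `Y₅ × E_k`, `k = ℚ(i)`, are algebraic granted Koike 2004 ALONE** (atlas row `E_k × Y₅(3,2)`,
`k = ℚ(i)`; refereed named fact `hK`, hyperbolic-sixfold form, applied DIRECTLY to the split pair of §1 — no Landherr,
no component binder): `Y₅` a fivefold, `φ ≫ φ = -1`, `ψ ≫ ψ = -1`, `(Y₅ × E, φ × ψ)` of Weil type `(3, 3)`.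
[cite: Koike2004WeilHodge, Thm. 2.1 and Cor. 2.1] [cite: vanGeemen1994HodgeAV, (5.4.1)] -/
theorem weilClasses_algebraic_fivefold_prod_curve_of_koike (hK : Koike2004_weilClasses_algebraic_hyperbolicSixfold_one)
    {A E : AbelianVariety ℂ} (hA : A.dim = 5) (hE : E.dim = 1) {φ : A ⟶ A} {ψ : E ⟶ E}
    (hφ : φ ≫ φ = -((1 : ℕ) • 𝟙 A)) (hψ : ψ ≫ ψ = -((1 : ℕ) • 𝟙 E))
    (hW : IsWeilType (A.prod E)
      (AbelianVariety.prodLift (AbelianVariety.fst A E ≫ φ) (AbelianVariety.snd A E ≫ ψ)) 3 1)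
    {c : complexBetti (A.prod E).X (2 * 3)} (hcQ : IsRationalClass c)
    (hcH : IsOfHodgeType (2 * 3) (A.prod E).X (2 * 3) 3 3 c)
    (hw : c ∈ weilClassesOf (A.prod E)
      (AbelianVariety.prodLift (AbelianVariety.fst A E ≫ φ) (AbelianVariety.snd A E ≫ ψ)) 3 1) :
    c ∈ algebraicClasses (A.prod E).X 3 := by
  obtain ⟨-, -, hP, hΦ2, e, a, ha, ha0, hh⟩ :=
    isSplitWeilType_iff.1 (isSplitWeilType_odd_prod_curve (m := 4) (N := 3) hA rfl (by norm_num) hE one_pos hφ hψ hW)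
  exact hK (A.prod E) _ hP (isSmoothProjective_of_dim_eq' hP) hΦ2 e a ha ha0 hh c hcQ hcH hw

/-- **The Weil classes of `Y₅ × E_k`, `k = ℚ(√-3)`, are algebraic granted Schoen 1998 ALONE** (refereed named fact
`hS`, applied directly to the split pair of §1). [cite: Schoen1998HodgeWeilAddendum] [cite: vanGeemen1994HodgeAV, 7.3 and (5.4.1)] -/
theorem weilClasses_algebraic_fivefold_prod_curve_of_schoen
    (hS : Schoen1998_weilClasses_algebraic_hyperbolicSixfold_three)
    {A E : AbelianVariety ℂ} (hA : A.dim = 5) (hE : E.dim = 1) {φ : A ⟶ A} {ψ : E ⟶ E}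
    (hφ : φ ≫ φ = -((3 : ℕ) • 𝟙 A)) (hψ : ψ ≫ ψ = -((3 : ℕ) • 𝟙 E))
    (hW : IsWeilType (A.prod E)
      (AbelianVariety.prodLift (AbelianVariety.fst A E ≫ φ) (AbelianVariety.snd A E ≫ ψ)) 3 3)
    {c : complexBetti (A.prod E).X (2 * 3)} (hcQ : IsRationalClass c)
    (hcH : IsOfHodgeType (2 * 3) (A.prod E).X (2 * 3) 3 3 c)
    (hw : c ∈ weilClassesOf (A.prod E)
      (AbelianVariety.prodLift (AbelianVariety.fst A E ≫ φ) (AbelianVariety.snd A E ≫ ψ)) 3 3) :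
    c ∈ algebraicClasses (A.prod E).X 3 := by
  obtain ⟨-, -, hP, hΦ2, e, a, ha, ha0, hh⟩ :=
    isSplitWeilType_iff.1
      (isSplitWeilType_odd_prod_curve (m := 4) (N := 3) hA rfl (by norm_num) hE (by norm_num) hφ hψ hW)
  exact hS (A.prod E) _ hP (isSmoothProjective_of_dim_eq' hP) hΦ2 e a ha ha0 hh c hcQ hcH hw

/-- **The Weil classes of `Y₅ × E_k`, any `k = ℚ(√-d)`, are algebraic granted Markman's hyperbolic-sixfold statement
F2 ALONE** (UNREFEREED named fact `hM`, applied directly to the split pair of §1).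
[cite: Markman2025SecantWeil, Thm. 1.5.1 (preprint, unrefereed)] [cite: vanGeemen1994HodgeAV, (5.4.1)] -/
theorem weilClasses_algebraic_fivefold_prod_curve_of_markmanSixfolds
    (hM : Markman2025_weilClasses_algebraic_hyperbolicSixfold)
    {A E : AbelianVariety ℂ} (hA : A.dim = 5) (hE : E.dim = 1) {d : ℕ} (hd : 0 < d) {φ : A ⟶ A} {ψ : E ⟶ E}
    (hφ : φ ≫ φ = -(d • 𝟙 A)) (hψ : ψ ≫ ψ = -(d • 𝟙 E))
    (hW : IsWeilType (A.prod E)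
      (AbelianVariety.prodLift (AbelianVariety.fst A E ≫ φ) (AbelianVariety.snd A E ≫ ψ)) 3 d)
    {c : complexBetti (A.prod E).X (2 * 3)} (hcQ : IsRationalClass c)
    (hcH : IsOfHodgeType (2 * 3) (A.prod E).X (2 * 3) 3 3 c)
    (hw : c ∈ weilClassesOf (A.prod E)
      (AbelianVariety.prodLift (AbelianVariety.fst A E ≫ φ) (AbelianVariety.snd A E ≫ ψ)) 3 d) :
    c ∈ algebraicClasses (A.prod E).X 3 := by
  obtain ⟨-, -, hP, hΦ2, e, a, ha, ha0, hh⟩ :=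
    isSplitWeilType_iff.1 (isSplitWeilType_odd_prod_curve (m := 4) (N := 3) hA rfl (by norm_num) hE hd hφ hψ hW)
  exact hM d hd (A.prod E) _ hP (isSmoothProjective_of_dim_eq' hP) hΦ2 e a ha ha0 hh c hcQ hcH hw

/-! ## §3 `(Y₄ × E) × E′` — a Weil-type FOURFOLD times two CM curves (atlas-2's carrier `Y′₄ × E₀²`, cells
`Ring2AtlasWeilCarriersEE*`): the factor `Y₄ × E` has ODD dimension `5` and `φ × ψ` squares to `-d` on it
(`prodLift_comp_self_eq_neg_nsmul`), so §1–§2 apply verbatim with `A := Y₄ × E`. -/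

/-- **`(Y₄ × E) × E′` of Weil type `(3, 3)` is SPLIT** (`Y₄` a fourfold, `E`, `E′` curves, all three endomorphisms squaring to
`-d`): §1 with `A := Y₄ × E` (dimension `5`). No named fact. [cite: vanGeemen1994HodgeAV, Lemma 5.2 (2)–(4), 5.4 and (5.4.1)]
[cite: Landherr1936HermitianForms] [cite: MoonenZarhin1999LowDim, Thm. 0.1 (a) and §5] -/
theorem isSplitWeilType_fourfold_prod_curve_prod_curve {Y E E' : AbelianVariety ℂ} (hY : Y.dim = 4) (hE : E.dim = 1)
    (hE' : E'.dim = 1) {d : ℕ} (hd : 0 < d) {φ : Y ⟶ Y} {ψ : E ⟶ E} {ψ' : E' ⟶ E'} (hφ : φ ≫ φ = -(d • 𝟙 Y))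
    (hψ : ψ ≫ ψ = -(d • 𝟙 E)) (hψ' : ψ' ≫ ψ' = -(d • 𝟙 E'))
    (hW : IsWeilType ((Y.prod E).prod E')
      (AbelianVariety.prodLift
        (AbelianVariety.fst (Y.prod E) E' ≫
          AbelianVariety.prodLift (AbelianVariety.fst Y E ≫ φ) (AbelianVariety.snd Y E ≫ ψ))
        (AbelianVariety.snd (Y.prod E) E' ≫ ψ')) 3 d) :
    IsSplitWeilType ((Y.prod E).prod E')
      (AbelianVariety.prodLift
        (AbelianVariety.fst (Y.prod E) E' ≫
          AbelianVariety.prodLift (AbelianVariety.fst Y E ≫ φ) (AbelianVariety.snd Y E ≫ ψ))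
        (AbelianVariety.snd (Y.prod E) E' ≫ ψ')) 3 d :=
  isSplitWeilType_odd_prod_curve (A := Y.prod E) (m := 4) (N := 3) (by rw [AbelianVariety.dim_prod, hY, hE]) rfl
    (by norm_num) hE' hd (prodLift_comp_self_eq_neg_nsmul hφ hψ) hψ' hW

/-- **The Weil classes of `(Y₄ × E) × E′` (type `(3,3)`, any `k = ℚ(√-d)`) are algebraic granted Markman's hyperbolic-sixfold
statement F2 ALONE** (UNREFEREED named fact `hM`; the atlas-2 carrier input "Weil classes on the split sixfold `Y′₄ × E₀²`").
[cite: Markman2025SecantWeil, Thm. 1.5.1 (preprint, unrefereed)] [cite: vanGeemen1994HodgeAV, (5.4.1)] -/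
theorem weilClasses_algebraic_fourfold_prod_curve_prod_curve_of_markmanSixfolds
    (hM : Markman2025_weilClasses_algebraic_hyperbolicSixfold)
    {Y E E' : AbelianVariety ℂ} (hY : Y.dim = 4) (hE : E.dim = 1) (hE' : E'.dim = 1) {d : ℕ} (hd : 0 < d) {φ : Y ⟶ Y}
    {ψ : E ⟶ E} {ψ' : E' ⟶ E'} (hφ : φ ≫ φ = -(d • 𝟙 Y)) (hψ : ψ ≫ ψ = -(d • 𝟙 E)) (hψ' : ψ' ≫ ψ' = -(d • 𝟙 E'))
    (hW : IsWeilType ((Y.prod E).prod E')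
      (AbelianVariety.prodLift
        (AbelianVariety.fst (Y.prod E) E' ≫
          AbelianVariety.prodLift (AbelianVariety.fst Y E ≫ φ) (AbelianVariety.snd Y E ≫ ψ))
        (AbelianVariety.snd (Y.prod E) E' ≫ ψ')) 3 d)
    {c : complexBetti ((Y.prod E).prod E').X (2 * 3)} (hcQ : IsRationalClass c)
    (hcH : IsOfHodgeType (2 * 3) ((Y.prod E).prod E').X (2 * 3) 3 3 c)
    (hw : c ∈ weilClassesOf ((Y.prod E).prod E')
      (AbelianVariety.prodLift
        (AbelianVariety.fst (Y.prod E) E' ≫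
          AbelianVariety.prodLift (AbelianVariety.fst Y E ≫ φ) (AbelianVariety.snd Y E ≫ ψ))
        (AbelianVariety.snd (Y.prod E) E' ≫ ψ')) 3 d) :
    c ∈ algebraicClasses ((Y.prod E).prod E').X 3 :=
  weilClasses_algebraic_fivefold_prod_curve_of_markmanSixfolds hM (A := Y.prod E)
    (by rw [AbelianVariety.dim_prod, hY, hE]) hE' hd (prodLift_comp_self_eq_neg_nsmul hφ hψ) hψ' hW hcQ hcH hw

/-- **The same granted Koike 2004 ALONE (`k = ℚ(i)`, refereed).** [cite: Koike2004WeilHodge, Thm. 2.1 and Cor. 2.1]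
[cite: vanGeemen1994HodgeAV, (5.4.1)] -/
theorem weilClasses_algebraic_fourfold_prod_curve_prod_curve_of_koike
    (hK : Koike2004_weilClasses_algebraic_hyperbolicSixfold_one)
    {Y E E' : AbelianVariety ℂ} (hY : Y.dim = 4) (hE : E.dim = 1) (hE' : E'.dim = 1) {φ : Y ⟶ Y} {ψ : E ⟶ E}
    {ψ' : E' ⟶ E'} (hφ : φ ≫ φ = -((1 : ℕ) • 𝟙 Y)) (hψ : ψ ≫ ψ = -((1 : ℕ) • 𝟙 E)) (hψ' : ψ' ≫ ψ' = -((1 : ℕ) • 𝟙 E'))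
    (hW : IsWeilType ((Y.prod E).prod E')
      (AbelianVariety.prodLift
        (AbelianVariety.fst (Y.prod E) E' ≫
          AbelianVariety.prodLift (AbelianVariety.fst Y E ≫ φ) (AbelianVariety.snd Y E ≫ ψ))
        (AbelianVariety.snd (Y.prod E) E' ≫ ψ')) 3 1)
    {c : complexBetti ((Y.prod E).prod E').X (2 * 3)} (hcQ : IsRationalClass c)
    (hcH : IsOfHodgeType (2 * 3) ((Y.prod E).prod E').X (2 * 3) 3 3 c)
    (hw : c ∈ weilClassesOf ((Y.prod E).prod E')
      (AbelianVariety.prodLift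
        (AbelianVariety.fst (Y.prod E) E' ≫
          AbelianVariety.prodLift (AbelianVariety.fst Y E ≫ φ) (AbelianVariety.snd Y E ≫ ψ))
        (AbelianVariety.snd (Y.prod E) E' ≫ ψ')) 3 1) :
    c ∈ algebraicClasses ((Y.prod E).prod E').X 3 :=
  weilClasses_algebraic_fivefold_prod_curve_of_koike hK (A := Y.prod E) (by rw [AbelianVariety.dim_prod, hY, hE]) hE'
    (prodLift_comp_self_eq_neg_nsmul hφ hψ) hψ' hW hcQ hcH hw

/-- **The same granted Schoen 1998 ALONE (`k = ℚ(√-3)`, refereed).** [cite: Schoen1998HodgeWeilAddendum]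
[cite: vanGeemen1994HodgeAV, 7.3 and (5.4.1)] -/
theorem weilClasses_algebraic_fourfold_prod_curve_prod_curve_of_schoen
    (hS : Schoen1998_weilClasses_algebraic_hyperbolicSixfold_three)
    {Y E E' : AbelianVariety ℂ} (hY : Y.dim = 4) (hE : E.dim = 1) (hE' : E'.dim = 1) {φ : Y ⟶ Y} {ψ : E ⟶ E}
    {ψ' : E' ⟶ E'} (hφ : φ ≫ φ = -((3 : ℕ) • 𝟙 Y)) (hψ : ψ ≫ ψ = -((3 : ℕ) • 𝟙 E)) (hψ' : ψ' ≫ ψ' = -((3 : ℕ) • 𝟙 E'))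
    (hW : IsWeilType ((Y.prod E).prod E')
      (AbelianVariety.prodLift
        (AbelianVariety.fst (Y.prod E) E' ≫
          AbelianVariety.prodLift (AbelianVariety.fst Y E ≫ φ) (AbelianVariety.snd Y E ≫ ψ))
        (AbelianVariety.snd (Y.prod E) E' ≫ ψ')) 3 3)
    {c : complexBetti ((Y.prod E).prod E').X (2 * 3)} (hcQ : IsRationalClass c)
    (hcH : IsOfHodgeType (2 * 3) ((Y.prod E).prod E').X (2 * 3) 3 3 c)
    (hw : c ∈ weilClassesOf ((Y.prod E).prod E')
      (AbelianVariety.prodLift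
        (AbelianVariety.fst (Y.prod E) E' ≫
          AbelianVariety.prodLift (AbelianVariety.fst Y E ≫ φ) (AbelianVariety.snd Y E ≫ ψ))
        (AbelianVariety.snd (Y.prod E) E' ≫ ψ')) 3 3) :
    c ∈ algebraicClasses ((Y.prod E).prod E').X 3 :=
  weilClasses_algebraic_fivefold_prod_curve_of_schoen hS (A := Y.prod E) (by rw [AbelianVariety.dim_prod, hY, hE]) hE'
    (prodLift_comp_self_eq_neg_nsmul hφ hψ) hψ' hW hcQ hcH hw

end Summit.HodgeConjecture.HodgeConjecture.Ring2.AbelianAll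

end
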